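import Literature.NumberTheory.Transcendental.KZLogCalculusProofs
import Literature.NumberTheory.Transcendental.KZDominatedFamilyRelations
import Literature.NumberTheory.Transcendental.KZIntervalPeriodProofs
import Literature.NumberTheory.Transcendental.MZVSimplexRep
import HarnessLib

/-!
# Parametrised simplex domains and the homotopy form of Kontsevich–Zagier's rule (3)

Theorem-only support file for the Kontsevich–Zagier calculus of moves (`KZCalculus.lean`), written
for the corner identities of the crux `PentagonInKZ` (route KontsevichZagierPeriods/FurushoPentagon,
line `logfree-gauge-corner-flatness`) but stated in general.  Two tools:

* **Rider × simplex domains.**  The sets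
  `{z : ℝ^{m+n} | ∀ k, 0 < z_k < 1, and (z_{m+i})_{i<n} strictly decreasing}` — a block of `m`
  free "rider" coordinates in the open unit cube times an open ordered simplex of `n` coordinates —
  are `ℚ`-semialgebraic, measurable, of finite volume, and carry the DOMINATION LEMMA
  `KZ.integrableOn_riderSimplex_of_le`: a semialgebraic function bounded by
  `C ∏_{i<n} z_{m+i}⁻¹` on the domain with `n + 1` simplex coordinates (a simple pole at `0` in
  every simplex variable except the innermost) is absolutely integrable — the parametrised form of
  the absolute convergence of iterated integrals whose innermost letter is not `dt/t`
  [Zagier1994, §9], via `KZ.prod_inv_le_prod_rpow`.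
* **Differentiation under the integral sign is ONE move** (`KZ.exists_homotopy_newtonLeibniz`):
  for a semialgebraic homotopy `F(z, v)`, `v ∈ [0,1]`, over a semialgebraic base `D` with fibrewise
  derivative `F_v`, the band representation `[D × [0,1], F_v]` is, modulo `KZ.relations`, the
  difference `[D, F(·,1)] − [D, F(·,0)]` (rule (3) with primitive `F` itself
  [KontsevichZagier2001, §1.2], then rule (1b)).  With `F(z,v) = ρ(s) θ(β(s)v, u)` this is the
  scaled fundamental theorem `θ(β) − θ(0) = β ∫₀¹ ∂_β θ(βv) dv` by which a factor `1/β` is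
  absorbed into one more rider coordinate.

* `KZ.exists_band_newtonLeibniz` — rule (3) over a semialgebraic base with semialgebraic fibre
  bounds `a ≤ b`, packaged (integration by parts in the last coordinate), and
  `KZ.of_sub_of_restrict_openBand_mem_relations` — closed versus open fibres differ by a null set.

No definitions and no named facts are introduced.
-/

noncomputable section

open MeasureTheory Set
open Literature.ModelTheory.ExponentialFields (IsSemialgebraic)

namespace Literature.NumberTheory.Transcendental

namespace KZ

variable {m n : ℕ}

/-! ## Rider × simplex domains -/

/-- The rider × simplex domain is `ℚ`-semialgebraic (finite intersection of strict polynomial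
inequalities). [folklore] -/
theorem isSemialgebraic_riderSimplex (m n : ℕ) : IsSemialgebraic ℚ {z : Fin (m + n) → ℝ | (∀ k, 0 < z k ∧ z k < 1) ∧ StrictAnti (fun i : Fin n => z (Fin.natAdd m i))} := by
  have h1 : IsSemialgebraic ℚ {z : Fin (m + n) → ℝ | ∀ k, 0 < z k} := by
    have : {z : Fin (m + n) → ℝ | ∀ k, 0 < z k} = ⋂ k ∈ (Finset.univ : Finset (Fin (m + n))),
        {z | 0 < MvPolynomial.aeval z (MvPolynomial.X k : MvPolynomial (Fin (m + n)) ℚ)} := by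
      ext z; simp
    rw [this]
    exact IsSemialgebraic.biInter _ _ fun k _ =>
      Literature.ModelTheory.ExponentialFields.isSemialgebraic_setOf_eval_pos _
  have h2 : IsSemialgebraic ℚ {z : Fin (m + n) → ℝ | ∀ k, z k < 1} := by
    have : {z : Fin (m + n) → ℝ | ∀ k, z k < 1} = ⋂ k ∈ (Finset.univ : Finset (Fin (m + n))),
        {z | 0 < MvPolynomial.aeval z
          (MvPolynomial.C 1 - MvPolynomial.X k : MvPolynomial (Fin (m + n)) ℚ)} := by
      ext z; simp [sub_pos]
    rw [this]
    exact IsSemialgebraic.biInter _ _ fun k _ =>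
      Literature.ModelTheory.ExponentialFields.isSemialgebraic_setOf_eval_pos _
  have h3 : IsSemialgebraic ℚ
      {z : Fin (m + n) → ℝ | StrictAnti (fun i : Fin n => z (Fin.natAdd m i))} := by
    have : {z : Fin (m + n) → ℝ | StrictAnti (fun i : Fin n => z (Fin.natAdd m i))} =
        ⋂ i ∈ (Finset.univ : Finset (Fin n)), ⋂ j ∈ (Finset.univ : Finset (Fin n)),
          (if i < j then {z | 0 < MvPolynomial.aeval z
            (MvPolynomial.X (Fin.natAdd m i) - MvPolynomial.X (Fin.natAdd m j) :
              MvPolynomial (Fin (m + n)) ℚ)} else Set.univ) := by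
      ext z
      simp only [mem_setOf_eq, Finset.mem_univ, iInter_true, mem_iInter]
      constructor
      · intro h i j
        split_ifs with hij
        · simpa [sub_pos] using h hij
        · trivial
      · intro h i j hij
        have := h i j
        rw [if_pos hij] at this
        simpa [sub_pos] using this
    rw [this]
    refine IsSemialgebraic.biInter _ _ fun i _ => IsSemialgebraic.biInter _ _ fun j _ => ?_
    split_ifs
    · exact Literature.ModelTheory.ExponentialFields.isSemialgebraic_setOf_eval_pos _
    · exact Literature.ModelTheory.ExponentialFields.isSemialgebraic_univ
  have : {z : Fin (m + n) → ℝ | (∀ k, 0 < z k ∧ z k < 1) ∧ StrictAnti (fun i : Fin n => z (Fin.natAdd m i))} = ({z | ∀ k, 0 < z k} ∩ {z | ∀ k, z k < 1}) ∩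
      {z : Fin (m + n) → ℝ | StrictAnti (fun i : Fin n => z (Fin.natAdd m i))} := by
    ext z
    simp only [mem_setOf_eq, mem_inter_iff]
    constructor
    · rintro ⟨h, h'⟩; exact ⟨⟨fun k => (h k).1, fun k => (h k).2⟩, h'⟩
    · rintro ⟨⟨h1, h2⟩, h'⟩; exact ⟨fun k => ⟨h1 k, h2 k⟩, h'⟩
  rw [this]
  exact (h1.inter h2).inter h3

/-- The rider × simplex domain is Lebesgue measurable. [folklore] -/
theorem measurableSet_riderSimplex (m n : ℕ) : MeasurableSet {z : Fin (m + n) → ℝ | (∀ k, 0 < z k ∧ z k < 1) ∧ StrictAnti (fun i : Fin n => z (Fin.natAdd m i))} :=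
  IsSemialgebraic.measurableSet_holds (isSemialgebraic_riderSimplex m n)

/-- The rider × simplex domain lies in the open unit cube. [folklore] -/
theorem riderSimplex_subset_pi (m n : ℕ) : {z : Fin (m + n) → ℝ | (∀ k, 0 < z k ∧ z k < 1) ∧ StrictAnti (fun i : Fin n => z (Fin.natAdd m i))} ⊆ Set.pi Set.univ fun _ => Ioo (0 : ℝ) 1 :=
  fun _ hz k _ => ⟨(hz.1 k).1, (hz.1 k).2⟩

/-- The rider × simplex domain has finite volume (it lies in the unit cube). [folklore] -/
theorem volume_riderSimplex_lt_top (m n : ℕ) : volume {z : Fin (m + n) → ℝ | (∀ k, 0 < z k ∧ z k < 1) ∧ StrictAnti (fun i : Fin n => z (Fin.natAdd m i))} < ⊤ := by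
  refine (measure_mono (riderSimplex_subset_pi m n)).trans_lt ?_
  rw [volume_pi_pi]
  simp

/-- A function bounded on the rider × simplex domain by a constant is integrable there. [folklore] -/
theorem integrableOn_riderSimplex_of_bounded {f : (Fin (m + n) → ℝ) → ℝ}
    (hf : IsSemialgebraicFunOn ℚ {z : Fin (m + n) → ℝ | (∀ k, 0 < z k ∧ z k < 1) ∧ StrictAnti (fun i : Fin n => z (Fin.natAdd m i))} f) (C : ℝ) (hC : ∀ z ∈ {z : Fin (m + n) → ℝ | (∀ k, 0 < z k ∧ z k < 1) ∧ StrictAnti (fun i : Fin n => z (Fin.natAdd m i))}, |f z| ≤ C) :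
    IntegrableOn f {z : Fin (m + n) → ℝ | (∀ k, 0 < z k ∧ z k < 1) ∧ StrictAnti (fun i : Fin n => z (Fin.natAdd m i))} := by
  refine ⟨KZ.aestronglyMeasurable_of_isSemialgebraicFunOn hf (measurableSet_riderSimplex m n),
    HasFiniteIntegral.restrict_of_bounded (C := C) (volume_riderSimplex_lt_top m n) ?_⟩
  exact (ae_restrict_mem (measurableSet_riderSimplex m n)).mono fun z hz => by
    rw [Real.norm_eq_abs]; exact hC z hz

/-- **Domination lemma.** On `kdom m (n+1)` a semialgebraic function bounded by
`C ∏_{i<n} z_{m+i}⁻¹` (simple poles at `0` in every simplex variable except the innermost one) is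
absolutely integrable: with `c = n/(n+1)` one has `∏_{i<n} uᵢ⁻¹ ≤ ∏_{i≤n} uᵢ^{-c}` on the ordered
simplex (`KZ.prod_inv_le_prod_rpow`), a product of one-variable functions integrable on `(0,1)`.
[cite: Zagier1994, §9] -/
theorem integrableOn_riderSimplex_of_le {f : (Fin (m + (n + 1)) → ℝ) → ℝ}
    (hf : IsSemialgebraicFunOn ℚ ({z : Fin (m + (n + 1)) → ℝ | (∀ k, 0 < z k ∧ z k < 1) ∧ StrictAnti (fun i : Fin (n + 1) => z (Fin.natAdd m i))}) f) (C : ℝ) (hC0 : 0 ≤ C)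
    (hC : ∀ z ∈ {z : Fin (m + (n + 1)) → ℝ | (∀ k, 0 < z k ∧ z k < 1) ∧ StrictAnti (fun i : Fin (n + 1) => z (Fin.natAdd m i))},
      |f z| ≤ C * ∏ i : Fin n, (z (Fin.natAdd m (Fin.castSucc i)))⁻¹) :
    IntegrableOn f ({z : Fin (m + (n + 1)) → ℝ | (∀ k, 0 < z k ∧ z k < 1) ∧ StrictAnti (fun i : Fin (n + 1) => z (Fin.natAdd m i))}) := by
  -- exponent
  set c : ℝ := n / (n + 1) with hc_def
  have hn : (0 : ℝ) < n + 1 := by positivity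
  have hc0 : 0 ≤ c := by positivity
  have hc1 : c < 1 := by rw [hc_def, div_lt_one hn]; linarith
  have h1c : 1 - c = 1 / (n + 1) := by rw [hc_def, one_sub_div hn.ne']; ring
  -- one-variable majorant and the dominating product
  set φ : ℝ → ℝ := (Ioo (0 : ℝ) 1).indicator fun x : ℝ => 2 * (x ^ (-c) + (1 - x) ^ (-c))
    with hφ_def
  have hφi : Integrable φ volume :=
    (KZ.integrableOn_Ioo_majorant hc1).integrable_indicator measurableSet_Ioo
  have hφ1 : ∀ x ∈ Ioo (0 : ℝ) 1, 1 ≤ φ x := by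
    intro x hx
    rw [hφ_def, indicator_of_mem hx]
    have h1 : 1 ≤ x ^ (-c) := Real.one_le_rpow_of_pos_of_le_one_of_nonpos hx.1 hx.2.le (by linarith)
    have h2 : 0 ≤ (1 - x) ^ (-c) := Real.rpow_nonneg (by linarith [hx.2]) _
    linarith
  have hg : Integrable (fun z : Fin (m + (n + 1)) → ℝ => C * ∏ k, φ (z k))
      (volume : Measure (Fin (m + (n + 1)) → ℝ)) :=
    (Integrable.fintype_prod (μ := fun _ : Fin (m + (n + 1)) => (volume : Measure ℝ))
      (f := fun _ => φ) fun _ => hφi).const_mul C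
  refine Integrable.mono' hg.integrableOn
    (KZ.aestronglyMeasurable_of_isSemialgebraicFunOn hf (measurableSet_riderSimplex m (n + 1)))
    ((ae_restrict_mem (measurableSet_riderSimplex m (n + 1))).mono fun z hz => ?_)
  rw [Real.norm_eq_abs]
  refine (hC z hz).trans (mul_le_mul_of_nonneg_left ?_ hC0)
  obtain ⟨hz01, hanti⟩ := hz
  -- the simplex block
  set u : Fin (n + 1) → ℝ := fun i => z (Fin.natAdd m i) with hu
  have hu0 : ∀ i, 0 < u i := fun i => (hz01 _).1
  have hu1 : ∀ i, u i ≤ 1 := fun i => (hz01 _).2.le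
  have hkey : ∏ i : Fin n, (u (Fin.castSucc i))⁻¹ ≤ ∏ i : Fin (n + 1), u i ^ (-c) := by
    have := KZ.prod_inv_le_prod_rpow (Finset.univ.image Fin.castSucc) u (Fin.last n)
      (by simp) hu0 hu1 (fun i => hanti.antitone (Fin.le_last i)) hc0 hc1.le
      (by
        rw [Finset.card_image_of_injective _ (Fin.castSucc_injective n), Finset.card_univ,
          Fintype.card_fin, h1c, hc_def]
        exact le_of_eq (by field_simp))
    rwa [Finset.prod_image fun i _ j _ h => Fin.castSucc_injective n h] at this
  -- compare with the full product of majorants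
  have hsplit : (∏ k : Fin (m + (n + 1)), φ (z k)) =
      (∏ j : Fin m, φ (z (Fin.castAdd (n + 1) j))) * ∏ i : Fin (n + 1), φ (u i) := by
    rw [Fin.prod_univ_add]
  have hR : 1 ≤ ∏ j : Fin m, φ (z (Fin.castAdd (n + 1) j)) :=
    Finset.one_le_prod fun j _ => hφ1 _ ⟨(hz01 _).1, (hz01 _).2⟩
  have hS : ∏ i : Fin (n + 1), u i ^ (-c) ≤ ∏ i : Fin (n + 1), φ (u i) := by
    refine Finset.prod_le_prod (fun i _ => Real.rpow_nonneg (hu0 i).le _) fun i _ => ?_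
    rw [hφ_def, indicator_of_mem (show u i ∈ Ioo (0:ℝ) 1 from ⟨hu0 i, (hz01 _).2⟩)]
    have h2 : 0 ≤ (1 - u i) ^ (-c) := Real.rpow_nonneg (by linarith [(hz01 (Fin.natAdd m i)).2]) _
    have h3 : 0 ≤ u i ^ (-c) := Real.rpow_nonneg (hu0 i).le _
    linarith
  calc ∏ i : Fin n, (z (Fin.natAdd m (Fin.castSucc i)))⁻¹
      = ∏ i : Fin n, (u (Fin.castSucc i))⁻¹ := rfl
    _ ≤ ∏ i : Fin (n + 1), u i ^ (-c) := hkey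
    _ ≤ 1 * ∏ i : Fin (n + 1), φ (u i) := by rw [one_mul]; exact hS
    _ ≤ (∏ j : Fin m, φ (z (Fin.castAdd (n + 1) j))) * ∏ i : Fin (n + 1), φ (u i) :=
        mul_le_mul_of_nonneg_right hR (Finset.prod_nonneg fun i _ =>
          le_trans (Real.rpow_nonneg (hu0 i).le _) (by
            rw [hφ_def, indicator_of_mem (show u i ∈ Ioo (0:ℝ) 1 from ⟨hu0 i, (hz01 _).2⟩)]
            have h2 : 0 ≤ (1 - u i) ^ (-c) := Real.rpow_nonneg (by linarith [(hz01 (Fin.natAdd m i)).2]) _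
            have h3 : 0 ≤ u i ^ (-c) := Real.rpow_nonneg (hu0 i).le _
            linarith))
    _ = ∏ k, φ (z k) := hsplit.symm


/-! ## The homotopy form of rule (3) -/

variable {N : ℕ}

/-- The unit band `D × [0, 1]` (last coordinate the homotopy parameter). [folklore] -/
theorem band_zero_one_eq (D : Set (Fin N → ℝ)) :
    KZlog.band D (fun _ => 0) (fun _ => 1) =
      {w : Fin (N + 1) → ℝ | Fin.init w ∈ D ∧ 0 ≤ w (Fin.last N) ∧ w (Fin.last N) ≤ 1} := rfl

/-- **Differentiation under the integral sign is one Newton–Leibniz move.**  Let `D ⊆ ℝᴺ` be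
`ℚ`-semialgebraic, `F` a `ℚ`-semialgebraic function on the band `D × [0,1]` which on each fibre is
continuous on `[0,1]` and has derivative `F_v` on `(0,1)`, with `F_v` semialgebraic and absolutely
integrable on the band and the two ends `F(·,1)`, `F(·,0)` semialgebraic and integrable on `D`.
Then the representations `[D × [0,1], F_v]`, `[D, F(·,1)]`, `[D, F(·,0)]` exist and
`[D × [0,1], F_v] − ([D, F(·,1)] − [D, F(·,0)]) ∈ KZ.relations`.
[cite: KontsevichZagier2001, §1.2 rule (3)] -/
theorem exists_homotopy_newtonLeibniz {D : Set (Fin N → ℝ)} (hD : IsSemialgebraic ℚ D)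
    (F Fv : (Fin (N + 1) → ℝ) → ℝ)
    (hF : IsSemialgebraicFunOn ℚ (KZlog.band D (fun _ => 0) (fun _ => 1)) F)
    (hFv : IsSemialgebraicFunOn ℚ (KZlog.band D (fun _ => 0) (fun _ => 1)) Fv)
    (hcont : ∀ z ∈ D, ContinuousOn (fun v : ℝ => F (Fin.snoc z v)) (Icc 0 1))
    (hder : ∀ z ∈ D, ∀ v ∈ Ioo (0 : ℝ) 1,
      HasDerivAt (fun v : ℝ => F (Fin.snoc z v)) (Fv (Fin.snoc z v)) v)
    (hint : IntegrableOn Fv (KZlog.band D (fun _ => 0) (fun _ => 1)))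
    (h1s : IsSemialgebraicFunOn ℚ D (fun z => F (Fin.snoc z 1)))
    (h0s : IsSemialgebraicFunOn ℚ D (fun z => F (Fin.snoc z 0)))
    (h1 : IntegrableOn (fun z => F (Fin.snoc z 1)) D)
    (h0 : IntegrableOn (fun z => F (Fin.snoc z 0)) D) :
    ∃ (rb : KZ.IntegralRep (N + 1)) (r1 r0 : KZ.IntegralRep N),
      rb.domain = KZlog.band D (fun _ => 0) (fun _ => 1) ∧ rb.integrand = Fv ∧
      r1.domain = D ∧ (r1.integrand = fun z => F (Fin.snoc z 1)) ∧
      r0.domain = D ∧ (r0.integrand = fun z => F (Fin.snoc z 0)) ∧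
      KZ.of rb - (KZ.of r1 - KZ.of r0) ∈ KZ.relations := by
  have hband : IsSemialgebraic ℚ (KZlog.band D (fun _ => (0 : ℝ)) (fun _ => 1)) := by
    have ha : IsSemialgebraicFunOn ℚ D (fun _ => (0 : ℝ)) := by
      simpa using isSemialgebraicFunOn_ratCast hD 0
    have hb : IsSemialgebraicFunOn ℚ D (fun _ => (1 : ℝ)) := by
      simpa using isSemialgebraicFunOn_ratCast hD 1
    exact KZlog.isSemialgebraic_band ha hb
  -- the three representations
  let rb : KZ.IntegralRep (N + 1) := ⟨KZlog.band D (fun _ => 0) (fun _ => 1), Fv, hband, hFv, hint⟩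
  let r1 : KZ.IntegralRep N := ⟨D, fun z => F (Fin.snoc z 1), hD, h1s, h1⟩
  let r0 : KZ.IntegralRep N := ⟨D, fun z => F (Fin.snoc z 0), hD, h0s, h0⟩
  -- the base of the Newton–Leibniz move: `[D, F(·,1) − F(·,0)]`
  let rd : KZ.IntegralRep N := ⟨D, fun z => F (Fin.snoc z 1) - F (Fin.snoc z 0), hD,
    IsSemialgebraicFunOn.sub_holds h1s h0s, h1.sub h0⟩
  have hNL : KZ.of rb - KZ.of rd ∈ KZ.relations := by
    refine KZ.newtonLeibnizRel_subset_relations ⟨N, rb, rd, fun _ => 0, fun _ => 1, F, hF,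
      by simpa using isSemialgebraicFunOn_ratCast hD 0, by simpa using isSemialgebraicFunOn_ratCast hD 1,
      fun _ _ => zero_le_one, rfl, fun z hz => hcont z hz, fun z hz v hv => hder z hz v hv,
      fun z _ => rfl, rfl⟩
  have hadd : KZ.of r1 - KZ.of rd - KZ.of r0 ∈ KZ.relations :=
    KZ.integrandAddRel_subset_relations ⟨N, r1, rd, r0, rfl, rfl, fun z _ => by
      simp [r1, rd, r0], rfl⟩
  refine ⟨rb, r1, r0, rfl, rfl, rfl, rfl, rfl, rfl, ?_⟩
  have : KZ.of rb - (KZ.of r1 - KZ.of r0) = (KZ.of rb - KZ.of rd) - (KZ.of r1 - KZ.of rd - KZ.of r0) := by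
    abel
  rw [this]
  exact KZ.relations.sub_mem hNL hadd


/-- **Rule (3) over a semialgebraic base, packaged.**  Let `B ⊆ ℝᴺ` be `ℚ`-semialgebraic,
`a ≤ b` two `ℚ`-semialgebraic functions on `B`, `F` a `ℚ`-semialgebraic function on the band
`{(x,t) | x ∈ B, a x ≤ t ≤ b x}` which on each fibre is continuous on `[a x, b x]` with derivative
`f` on `(a x, b x)`, `f` semialgebraic and absolutely integrable on the band, and the boundary
function `x ↦ F(x, b x) − F(x, a x)` semialgebraic and integrable on `B`.  Then the band
representation `[band, f]` and the base representation `[B, F(·,b) − F(·,a)]` exist and differ by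
a relation (integration by parts / Newton–Leibniz in the last coordinate).
[cite: KontsevichZagier2001, §1.2 rule (3)] -/
theorem exists_band_newtonLeibniz {B : Set (Fin N → ℝ)} (hB : IsSemialgebraic ℚ B)
    (a b : (Fin N → ℝ) → ℝ) (ha : IsSemialgebraicFunOn ℚ B a) (hb : IsSemialgebraicFunOn ℚ B b)
    (hab : ∀ x ∈ B, a x ≤ b x) (F f : (Fin (N + 1) → ℝ) → ℝ)
    (hF : IsSemialgebraicFunOn ℚ (KZlog.band B a b) F)
    (hf : IsSemialgebraicFunOn ℚ (KZlog.band B a b) f)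
    (hcont : ∀ x ∈ B, ContinuousOn (fun t : ℝ => F (Fin.snoc x t)) (Icc (a x) (b x)))
    (hder : ∀ x ∈ B, ∀ t ∈ Ioo (a x) (b x),
      HasDerivAt (fun t : ℝ => F (Fin.snoc x t)) (f (Fin.snoc x t)) t)
    (hint : IntegrableOn f (KZlog.band B a b))
    (hds : IsSemialgebraicFunOn ℚ B (fun x => F (Fin.snoc x (b x)) - F (Fin.snoc x (a x))))
    (hdi : IntegrableOn (fun x => F (Fin.snoc x (b x)) - F (Fin.snoc x (a x))) B) :
    ∃ (rb : IntegralRep (N + 1)) (rd : IntegralRep N),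
      rb.domain = KZlog.band B a b ∧ rb.integrand = f ∧ rd.domain = B ∧
      (rd.integrand = fun x => F (Fin.snoc x (b x)) - F (Fin.snoc x (a x))) ∧
      of rb - of rd ∈ relations := by
  have hband : IsSemialgebraic ℚ (KZlog.band B a b) := KZlog.isSemialgebraic_band ha hb
  let rb : IntegralRep (N + 1) := ⟨KZlog.band B a b, f, hband, hf, hint⟩
  let rd : IntegralRep N := ⟨B, fun x => F (Fin.snoc x (b x)) - F (Fin.snoc x (a x)), hB, hds, hdi⟩
  refine ⟨rb, rd, rfl, rfl, rfl, rfl, ?_⟩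
  exact newtonLeibnizRel_subset_relations ⟨N, rb, rd, a, b, F, hF, ha, hb, hab, rfl,
    fun x hx => hcont x hx, fun x hx t ht => hder x hx t ht, fun x _ => rfl, rfl⟩

/-- **Closing or opening the fibres of a band costs nothing**: the band with closed fibres
`[a x, b x]` and the same data restricted to the open fibres `(a x, b x)` differ by a null set
(two graphs), so their representations are equivalent. [cite: KontsevichZagier2001, §1.2 rule (1)] -/
theorem of_sub_of_restrict_openBand_mem_relations {B : Set (Fin N → ℝ)}
    {a b : (Fin N → ℝ) → ℝ} (ha : IsSemialgebraicFunOn ℚ B a) (hb : IsSemialgebraicFunOn ℚ B b)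
    (r : IntegralRep (N + 1)) (hr : r.domain = KZlog.band B a b) :
    ∃ r' : IntegralRep (N + 1),
      r'.domain = {z : Fin (N + 1) → ℝ | Fin.init z ∈ B ∧ a (Fin.init z) < z (Fin.last N) ∧
        z (Fin.last N) < b (Fin.init z)} ∧
      r'.integrand = r.integrand ∧ of r - of r' ∈ relations := by
  set O : Set (Fin (N + 1) → ℝ) :=
    {z | Fin.init z ∈ B ∧ a (Fin.init z) < z (Fin.last N) ∧ z (Fin.last N) < b (Fin.init z)} with hO
  have hOsa : IsSemialgebraic ℚ O := by
    have hGa : IsSemialgebraic ℚ {z : Fin (N + 1) → ℝ | Fin.init z ∈ B ∧ z (Fin.last N) = a (Fin.init z)} :=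
      isSemialgebraicFunOn_iff.mp ha
    have hGb : IsSemialgebraic ℚ {z : Fin (N + 1) → ℝ | Fin.init z ∈ B ∧ z (Fin.last N) = b (Fin.init z)} :=
      isSemialgebraicFunOn_iff.mp hb
    have h := (KZlog.isSemialgebraic_band ha hb).diff (hGa.union hGb)
    convert h using 1
    ext z
    simp only [hO, mem_setOf_eq, mem_sdiff, mem_union, KZlog.mem_band, not_or, not_and]
    constructor
    · rintro ⟨hzB, h1, h2⟩
      exact ⟨⟨hzB, h1.le, h2.le⟩, fun _ => h1.ne', fun _ => h2.ne⟩
    · rintro ⟨⟨hzB, h1, h2⟩, h3, h4⟩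
      exact ⟨hzB, lt_of_le_of_ne h1 (fun h => h3 hzB h.symm), lt_of_le_of_ne h2 (h4 hzB)⟩
  have hsub : O ⊆ r.domain := by
    rw [hr]; intro z hz; exact ⟨hz.1, hz.2.1.le, hz.2.2.le⟩
  have hnull : volume (r.domain \ O) = 0 := by
    have hcov : r.domain \ O ⊆ {z | Fin.init z ∈ B ∧ z (Fin.last N) = a (Fin.init z)} ∪
        {z | Fin.init z ∈ B ∧ z (Fin.last N) = b (Fin.init z)} := by
      intro z hz
      rw [hr] at hz
      obtain ⟨⟨hzB, h1, h2⟩, hzO⟩ := hz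
      simp only [hO, mem_setOf_eq, not_and, not_lt] at hzO
      rcases h1.lt_or_eq with h1 | h1
      · have h3 := hzO hzB h1
        exact Or.inr ⟨hzB, le_antisymm h2 h3⟩
      · exact Or.inl ⟨hzB, h1.symm⟩
    exact measure_mono_null hcov (measure_union_null (volume_graph_eq_zero ha) (volume_graph_eq_zero hb))
  refine ⟨r.restrict O hOsa hsub, rfl, rfl, ?_⟩
  exact r.of_sub_of_restrict_mem_relations hOsa hsub hnull

end KZ

end Literature.NumberTheory.Transcendental
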